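import Mathlib
import Summits.ValiantsHypothesis.ValiantsHypothesis.Theorems.NewtonUnitEquationsNewtonTauWeakVdpDefs
import Summits.ValiantsHypothesis.ValiantsHypothesis.Theorems.NewtonUnitEquationsTwoProductsExposure

/-!
# `NewtonTauWeak` (stmt-ValiantsHypothesis-5904), line `euler-wronskian-vdp`: vertex charts

Stub `stub_vertexCharts` of the lead's skeleton: every vertex of the Newton polygon of
`s ∈ ℂ[X,Y]` is `emb e` for an exponent `e` which is the strict top of `s` for a GENERIC weight of
the form `(1, t)` or `(-1, t)`; hence `V(s) ≤ #T₊ + #T₋`, where `T_σ` is the set of strict tops of `s`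
along the affine chart of weights `w = (σ, t)`, `t ∈ ℝ`, `w` generic.

Proof.
* `VertexCharts.exists_isTop_of_mem_extremePoints`: a vertex is strictly exposed by a real form
  (`TwoProducts.Exposure.exists_real_form_of_mem_extremePoints`, negated to get a strict maximiser),
  i.e. it is `emb e` with `IsTop η s e` for some real weight `η`.
* `VertexCharts.isOpen_setOf_forall_lt`: on a finite set of exponents strict exposure is an open
  condition on the weight.
* `VertexCharts.dense_charts`: the weights `w` with `w₀ ∈ ℚ ∖ {0}` and `w₁ ∉ ℚ` are dense
  (`Rat.denseRange_cast`, `dense_irrational`, `dense_pi`), and each of them is generic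
  (`VertexCharts.isGeneric_of_rat_of_irrational`: `w₀ (a₀ - b₀) = w₁ (b₁ - a₁)` with `w₁ ∉ ℚ`
  forces `a₁ = b₁`, then `a₀ = b₀` as `w₀ ≠ 0`).
* `VertexCharts.exists_chart_of_isTop`: pick such a `w` in the open set of exposing weights and
  rescale by `|w₀|⁻¹ > 0` (`IsGeneric.smul`, `IsTop.smul_pos`): the new weight is `(±1, t)`.
* `stub_vertexCharts`: `extremePoints ⊆ emb '' (T₊ ∪ T₋)` and `ncard` is monotone and subadditive.
[folklore]
-/

-- the namespace mandated for this Theorems file repeats the component `ValiantsHypothesis`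
set_option linter.dupNamespace false

noncomputable section

namespace Summit.ValiantsHypothesis.ValiantsHypothesis.Theorems.NewtonUnitEquationsNewtonTauWeak

open scoped BigOperators Polynomial
open MvPolynomial
open Literature.Computability.AlgebraicComplexity (newtonVertexCount)
open Summit.ValiantsHypothesis.ValiantsHypothesis.Theorems.NewtonTauWeakVdp

namespace VertexCharts

/-! ## Generic weights from a rational and an irrational coordinate -/

/-- A weight with `w₀ ∈ ℚ ∖ {0}` and `w₁ ∉ ℚ` is generic: `⟨w, a⟩ = ⟨w, b⟩` on `ℕ²` forces `a = b`
(`w₁ (a₁ - b₁) = w₀ (b₀ - a₀)` is rational, so `a₁ = b₁`, and then `a₀ = b₀`). [folklore] -/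
theorem isGeneric_of_rat_of_irrational (w : Fin 2 → ℝ) (q : ℚ) (hq : q ≠ 0) (hw0 : w 0 = q)
    (hw1 : Irrational (w 1)) : IsGeneric w := by
  intro a b h
  unfold wdeg at h
  rw [hw0] at h
  have h1 : ((a 1 : ℕ) : ℤ) = ((b 1 : ℕ) : ℤ) := by
    by_contra hne
    have hI : Irrational (w 1 * ((((a 1 : ℕ) : ℤ) - ((b 1 : ℕ) : ℤ) : ℤ) : ℝ)) :=
      hw1.mul_intCast (sub_ne_zero.mpr hne)
    refine hI.ne_rat (q * (((b 0 : ℕ) : ℚ) - ((a 0 : ℕ) : ℚ))) ?_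
    push_cast
    linear_combination h
  have h1' : a 1 = b 1 := by exact_mod_cast h1
  have h1r : ((a 1 : ℕ) : ℝ) = ((b 1 : ℕ) : ℝ) := by exact_mod_cast h1'
  rw [h1r] at h
  have hq' : (q : ℝ) ≠ 0 := by exact_mod_cast hq
  have h0 : ((a 0 : ℕ) : ℝ) = ((b 0 : ℕ) : ℝ) := mul_left_cancel₀ hq' (add_right_cancel h)
  have h0' : a 0 = b 0 := by exact_mod_cast h0
  ext i
  fin_cases i
  · exact h0'
  · exact h1'

/-- The weights `w` with `w₀ ∈ ℚ ∖ {0}` and `w₁ ∉ ℚ` are dense in `ℝ²`. [folklore] -/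
theorem dense_charts :
    Dense (Set.pi Set.univ ![Set.range ((↑) : ℚ → ℝ) \ {0}, {x : ℝ | Irrational x}]) := by
  have h0 : Dense (Set.range ((↑) : ℚ → ℝ) \ {0}) := Dense.sdiff_singleton Rat.denseRange_cast 0
  have h1 : Dense {x : ℝ | Irrational x} := dense_irrational
  refine dense_pi Set.univ fun i _ => ?_
  fin_cases i
  · exact h0
  · exact h1

/-! ## Strict exposure is open in the weight -/

/-- The weighted degree of a fixed exponent is continuous in the weight. [folklore] -/
theorem continuous_wdeg (e : Fin 2 →₀ ℕ) : Continuous fun w : Fin 2 → ℝ => wdeg w e := by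
  unfold wdeg
  fun_prop

/-- Strict exposure of `e` over a finite set of exponents is an open condition on the weight. [folklore] -/
theorem isOpen_setOf_forall_lt (S : Finset (Fin 2 →₀ ℕ)) (e : Fin 2 →₀ ℕ) :
    IsOpen {w : Fin 2 → ℝ | ∀ e' ∈ S, e' ≠ e → wdeg w e' < wdeg w e} := by
  have h : {w : Fin 2 → ℝ | ∀ e' ∈ S, e' ≠ e → wdeg w e' < wdeg w e} =
      ⋂ e' ∈ S, {w : Fin 2 → ℝ | e' ≠ e → wdeg w e' < wdeg w e} := by
    ext w
    simp only [Set.mem_setOf_eq, Set.mem_iInter]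
  rw [h]
  refine isOpen_biInter_finset fun e' _ => ?_
  by_cases hne : e' = e
  · simp [hne]
  · simp only [ne_eq, hne, not_false_eq_true, forall_const]
    exact isOpen_lt (continuous_wdeg e') (continuous_wdeg e)

/-! ## From a vertex to a generic chart weight -/

/-- A vertex of the Newton polygon of `s` is `emb e` for a strict top `e` of `s` with respect to
some real weight (strict exposure by a real form,
`TwoProducts.Exposure.exists_real_form_of_mem_extremePoints`, negated). [folklore] -/
theorem exists_isTop_of_mem_extremePoints (s : MvPolynomial (Fin 2) ℂ) {p : Fin 2 → ℝ}
    (hp : p ∈ Set.extremePoints ℝ (convexHull ℝ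
      ((fun e : Fin 2 →₀ ℕ => fun i : Fin 2 => ((e i : ℕ) : ℝ)) '' (s.support : Set (Fin 2 →₀ ℕ))))) :
    ∃ e : Fin 2 →₀ ℕ, (fun i : Fin 2 => ((e i : ℕ) : ℝ)) = p ∧ ∃ η : Fin 2 → ℝ, IsTop η s e := by
  have hfin : ((fun e : Fin 2 →₀ ℕ => fun i : Fin 2 => ((e i : ℕ) : ℝ)) ''
      (s.support : Set (Fin 2 →₀ ℕ))).Finite := s.support.finite_toSet.image _
  obtain ⟨hpT, ξ, hξ⟩ :=
    Summit.ValiantsHypothesis.ValiantsHypothesis.Theorems.TwoProducts.Exposure.exists_real_form_of_mem_extremePoints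
      _ hfin p hp
  obtain ⟨e, he, rfl⟩ := hpT
  refine ⟨e, rfl, -ξ, ⟨Finset.mem_coe.1 he, fun e' he' hne => ?_⟩⟩
  have hne' : (fun i : Fin 2 => ((e' i : ℕ) : ℝ)) ≠ (fun i : Fin 2 => ((e i : ℕ) : ℝ)) := by
    intro h
    apply hne
    ext i
    exact_mod_cast congr_fun h i
  have hlt := hξ _ ⟨e', Finset.mem_coe.2 he', rfl⟩ hne'
  dsimp only at hlt
  simp only [wdeg, Pi.neg_apply, neg_mul]
  linarith

/-- A strict top for SOME real weight is a strict top for a generic weight of the form `(1, t)` or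
`(-1, t)`: perturb the weight inside the open set of exposing weights to one with `w₀ ∈ ℚ ∖ {0}`
and `w₁ ∉ ℚ` (a dense set of generic weights), then rescale by `|w₀|⁻¹ > 0`. [folklore] -/
theorem exists_chart_of_isTop {s : MvPolynomial (Fin 2) ℂ} {e : Fin 2 →₀ ℕ} {η : Fin 2 → ℝ}
    (h : IsTop η s e) :
    (∃ t : ℝ, IsGeneric ![(1 : ℝ), t] ∧ IsTop ![(1 : ℝ), t] s e) ∨
      (∃ t : ℝ, IsGeneric ![(-1 : ℝ), t] ∧ IsTop ![(-1 : ℝ), t] s e) := by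
  obtain ⟨w, hwD, hwU⟩ :=
    dense_charts.exists_mem_open (isOpen_setOf_forall_lt s.support e) ⟨η, h.2⟩
  have hw0 : w 0 ∈ Set.range ((↑) : ℚ → ℝ) \ {0} := (Set.mem_univ_pi.1 hwD) 0
  have hw1 : Irrational (w 1) := (Set.mem_univ_pi.1 hwD) 1
  obtain ⟨⟨q, hq⟩, hw0'⟩ := hw0
  have hne : w 0 ≠ 0 := fun h0 => hw0' (Set.mem_singleton_iff.2 h0)
  have hq0 : (q : ℝ) ≠ 0 := by
    rw [hq]
    exact hne
  have hqne : q ≠ 0 := by exact_mod_cast hq0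
  have hgen : IsGeneric w := isGeneric_of_rat_of_irrational w q hqne hq.symm hw1
  have htop : IsTop w s e := ⟨h.mem, hwU⟩
  -- rescale by a positive constant so that the first coordinate becomes `±1`
  obtain ⟨c, hc, hcw⟩ : ∃ c : ℝ, 0 < c ∧ (c * w 0 = 1 ∨ c * w 0 = -1) := by
    rcases lt_or_gt_of_ne hne with hneg | hpos
    · refine ⟨(-(w 0))⁻¹, inv_pos.mpr (neg_pos.mpr hneg), Or.inr ?_⟩
      rw [inv_neg, neg_mul, inv_mul_cancel₀ hne]
    · exact ⟨(w 0)⁻¹, inv_pos.mpr hpos, Or.inl (inv_mul_cancel₀ hne)⟩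
  have hgen' : IsGeneric (c • w) := hgen.smul hc.ne'
  have htop' : IsTop (c • w) s e := htop.smul_pos hc
  have hv : c • w = ![c * w 0, (c • w) 1] := (FinVec.etaExpand_eq _).symm
  rcases hcw with h1 | h1
  · left
    refine ⟨(c • w) 1, ?_⟩
    rw [h1] at hv
    rw [← hv]
    exact ⟨hgen', htop'⟩
  · right
    refine ⟨(c • w) 1, ?_⟩
    rw [h1] at hv
    rw [← hv]
    exact ⟨hgen', htop'⟩

end VertexCharts

/-- **Stub `stub_vertexCharts` (vertex charts).** Every vertex of `Newt(s)` is `emb e` for an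
exponent `e` that is the strict top of `s` for some GENERIC weight `(1, t)` or `(-1, t)`; hence
`V(s) ≤ #T₊ + #T₋` with `T_σ = {e | ∃ t, (σ, t) generic ∧ e = top_{(σ,t)} s}`. [folklore] -/
theorem stub_vertexCharts :
    ∀ (s : MvPolynomial (Fin 2) ℂ),
      newtonVertexCount s ≤
        {e : Fin 2 →₀ ℕ | ∃ t : ℝ, IsGeneric ![(1 : ℝ), t] ∧ IsTop ![(1 : ℝ), t] s e}.ncard +
          {e : Fin 2 →₀ ℕ | ∃ t : ℝ, IsGeneric ![(-1 : ℝ), t] ∧ IsTop ![(-1 : ℝ), t] s e}.ncard := by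
  intro s
  set Tp : Set (Fin 2 →₀ ℕ) :=
    {e : Fin 2 →₀ ℕ | ∃ t : ℝ, IsGeneric ![(1 : ℝ), t] ∧ IsTop ![(1 : ℝ), t] s e} with hTp
  set Tm : Set (Fin 2 →₀ ℕ) :=
    {e : Fin 2 →₀ ℕ | ∃ t : ℝ, IsGeneric ![(-1 : ℝ), t] ∧ IsTop ![(-1 : ℝ), t] s e} with hTm
  have hsubp : Tp ⊆ (s.support : Set (Fin 2 →₀ ℕ)) := fun e ⟨_, _, ht⟩ => Finset.mem_coe.2 ht.mem
  have hsubm : Tm ⊆ (s.support : Set (Fin 2 →₀ ℕ)) := fun e ⟨_, _, ht⟩ => Finset.mem_coe.2 ht.mem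
  have hfin : (Tp ∪ Tm).Finite :=
    (s.support.finite_toSet.subset hsubp).union (s.support.finite_toSet.subset hsubm)
  have hcover : Set.extremePoints ℝ (convexHull ℝ
      ((fun e : Fin 2 →₀ ℕ => fun i : Fin 2 => ((e i : ℕ) : ℝ)) '' (s.support : Set (Fin 2 →₀ ℕ)))) ⊆
      (fun e : Fin 2 →₀ ℕ => fun i : Fin 2 => ((e i : ℕ) : ℝ)) '' (Tp ∪ Tm) := by
    intro p hp
    obtain ⟨e, rfl, η, hη⟩ := VertexCharts.exists_isTop_of_mem_extremePoints s hp
    refine ⟨e, ?_, rfl⟩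
    rcases VertexCharts.exists_chart_of_isTop hη with h | h
    · exact Or.inl h
    · exact Or.inr h
  calc newtonVertexCount s
      ≤ ((fun e : Fin 2 →₀ ℕ => fun i : Fin 2 => ((e i : ℕ) : ℝ)) '' (Tp ∪ Tm)).ncard :=
        Set.ncard_le_ncard hcover (hfin.image _)
    _ ≤ (Tp ∪ Tm).ncard := Set.ncard_image_le hfin
    _ ≤ Tp.ncard + Tm.ncard := Set.ncard_union_le _ _

end Summit.ValiantsHypothesis.ValiantsHypothesis.Theorems.NewtonUnitEquationsNewtonTauWeak

end
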